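import Summits.QuantumFields.YangMills.Theorems.PoincareLipschitzHistoryTailOfFactsQuantile
import Summits.QuantumFields.YangMills.Theorems.PoincareLipschitzTangentMapDensityCapHolds
import Summits.QuantumFields.YangMills.Theorems.PoincareLipschitzMeanDeviationOfSecondMoment
import HarnessLib

/-!
# Crux `HistoryTailL` (stmt-QuantumFields-19936) — FILE K-15: the K2-LANE FACE v11 «THE CONTINUUM ROW IS THE 8π GAP»
# (secondary face of record, ★★OWNER RULING №28; display of record = the one-row sandwich face ✓p729779)

Cell `ym3-torus` (YM ladder rung R3 = continuum SU(2) Yang–Mills on T³ — a RUNG, NOT the Clay problem: not d = 4, not infinite volume, not a mass gap);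
LEAD seat `ym-ust-19936-w1` g10.  Helper `--supports stmt-QuantumFields-19936`; THEOREMS ONLY; compositions by landed names: the K2 organ chain of ✓K-12 p730074
(`blockLipschitzL_of_hImprove ∘ hImprove_of_core ∘ hImproveCore_of_flat ∘ hImproveCoreFlat_of_stubs (·) stub_latticeToContinuumLimit`) fed with ★px3 g9's
HYPOTHESIS-FREE central density cap ✓p731550 `PoincareLipschitzTangentMapDensityCapHolds.uniformSmallScaleEnergy_band_of_gap (hGap) : ⟨S1″-band⟩` — every
minimizing tangent map `ℝ³ → S³` has `Θ ≤ 3π` BY KERNEL (blow-up ∘ Luckhaus ✓p730588 ∘ w7 g14's stability ∘ Hardy ∘ ★w3∕w2's monotonicity), so the ONLY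
continuum input left is the ENERGY GAP (GAP): «a map of the class with LINEAR central ball energies of slope `Θ ≤ 3π` has `Θ = 0`» [Schoen–Uhlenbeck 1984,
Lemma 1.1: non-constant harmonic 2-spheres in `S³` have energy in `8πℕ`, read through homogeneity; implied by lit `MinimisingTangentMapConstant`].

THE DISPLAYED BINDERS (v11).  `hK1` = K1-exp (crux stmt-QuantumFields-23532's exponential letter); `hGap` = (GAP), ★px3 g9's frozen binder text 30a3f4556be5a68a
VERBATIM — an UNREGISTERED print-class statement (not yet a Literature named fact; ★w3 g16 ∕ px19 g8 are working to DISCHARGE it by the H-system ∕ Wente road);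
first-moment row: `hQ` = (Q) (registry row, 23133) resp. `hSM` = «BlockSecondMomentL» (OPEN, UNREGISTERED — ★★OWNER WORD 34's label: the Gaussian-size
second-moment bound, Bałaban-class, not printed; stronger than (Q) and `MeanDeviationL`).  Census v10 ✓p731935 → v11: removed [hT] · added [hGap] · changed [].
NOTHING of K1-exp, (GAP), (Q) or `hSM` is proved here; `HistoryTailL` is NOT proved.

WHAT IS PROVED (ns `…Theorems.PoincareLipschitzHistoryTailOfGap`).
* ★★★ `blockLipschitzL_of_gap (hGap) : PoincareLipschitz.BlockLipschitzL` — THE K2 CRUX stmt-QuantumFields-23533 MODULO THE 8π GAP ALONE.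
* ★★★ `historyTailL_of_gap_quantile (hK1) (hGap) (hQ) : UnitScaleTilt.HistoryTailL` — all-registry-rows face but for (GAP).
* ★★★ `historyTailL_of_gap_secondMoment (hK1) (hGap) (hSM) : UnitScaleTilt.HistoryTailL`.
HONEST SCOPE.  Compositions by landed names only; YM₃ on T³ is rung R3, not Clay; YM gap NOT proved.

References: T. Bałaban, CMP 102 (1985) 255–275 [Balaban1985UV3]; R. Schoen, K. Uhlenbeck, Invent. Math. 78 (1984) 89–100 [SchoenUhlenbeck1984] (Lemma 1.1,
Prop. 1.2); S. Luckhaus (1988) [Luckhaus1988].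
-/

set_option autoImplicit false

noncomputable section

namespace Summit.QuantumFields.YangMills.Theorems.PoincareLipschitzHistoryTailOfGap

open MeasureTheory Filter Topology Finset Metric
open scoped BigOperators
open Literature.Analysis.FunctionSpaces
open Literature.MathematicalPhysics.QuantumFieldTheory.Balaban1983to89
open Literature.MathematicalPhysics.QuantumFieldTheory.Balaban1983to89.T3ContinuumYM3Torus
open Literature.MathematicalPhysics.QuantumFieldTheory.Balaban1983to89.T3UnitScaleTilt
open Literature.MathematicalPhysics.QuantumFieldTheory.Balaban1983to89.T3UnitLawDensityEML (ℰp)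
open B4Eq19LatticeOperators (Zd box unitVec)
open Summit.QuantumFields.YangMills.Theorems.PoincareLipschitzFlatOrganOfSobolevStubs (hImproveCoreFlat_of_stubs)
open Summit.QuantumFields.YangMills.Theorems.PoincareLipschitzCompactnessTransferLatticeToContinuumLimitStub (stub_latticeToContinuumLimit)
open Summit.QuantumFields.YangMills.Theorems.PoincareLipschitzImproveCoreOfFlat (hImproveCore_of_flat)
open Summit.QuantumFields.YangMills.Theorems.PoincareLipschitzImproveOfCore (hImprove_of_core)
open Summit.QuantumFields.YangMills.Theorems.PoincareLipschitzOrbitMinHolderRegularityOfImprove (blockLipschitzL_of_hImprove)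
open Summit.QuantumFields.YangMills.Theorems.PoincareLipschitz.MedianCentring (historyTailL_of_expConcentration_quantile)
open Summit.QuantumFields.YangMills.Theorems.PoincareLipschitzTangentMapDensityCapHolds (uniformSmallScaleEnergy_band_of_gap)
open Summit.QuantumFields.YangMills.Theorems.PoincareLipschitzMeanDeviationOfSecondMoment (quantileDeviation_of_secondMoment)

/-- ★★★ **THE K2 CRUX `BlockLipschitzL` (stmt-QuantumFields-23533) MODULO THE 8π GAP ALONE.** [cite: SchoenUhlenbeck1984, Lemma 1.1; Luckhaus1988, Thm 2] -/
theorem blockLipschitzL_of_gap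
    (hGap : ∀ (hQ : IsOpen {x : EuclideanSpace ℝ (Fin 3) | ∀ i : Fin 3, |x i| < 1}) (U : EuclideanSpace ℝ (Fin 3) → EuclideanSpace ℝ (Fin 4)) (G : EuclideanSpace ℝ (Fin 3) → (EuclideanSpace ℝ (Fin 3) →L[ℝ] EuclideanSpace ℝ (Fin 4))),
      (HasWeakFDerivOn ⟨{x : EuclideanSpace ℝ (Fin 3) | ∀ i : Fin 3, |x i| < 1}, hQ⟩ volume U G ∧
        (∀ x : EuclideanSpace ℝ (Fin 3), (∀ i : Fin 3, |x i| < 1) → ‖U x‖ = 1) ∧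
        IntegrableOn (fun x => ∑ i : Fin 3, ‖G x (EuclideanSpace.single i (1:ℝ))‖ ^ 2) {x : EuclideanSpace ℝ (Fin 3) | ∀ i : Fin 3, |x i| < 1} ∧
        (∀ (y : EuclideanSpace ℝ (Fin 3)) (ρ : ℝ), 0 < ρ → closedBall y ρ ⊆ {x : EuclideanSpace ℝ (Fin 3) | ∀ i : Fin 3, |x i| < 1} →
          ∀ (W : EuclideanSpace ℝ (Fin 3) → EuclideanSpace ℝ (Fin 4)) (GW : EuclideanSpace ℝ (Fin 3) → (EuclideanSpace ℝ (Fin 3) →L[ℝ] EuclideanSpace ℝ (Fin 4))),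
          HasWeakFDerivOn ⟨{x : EuclideanSpace ℝ (Fin 3) | ∀ i : Fin 3, |x i| < 1}, hQ⟩ volume W GW →
          (∀ x : EuclideanSpace ℝ (Fin 3), (∀ i : Fin 3, |x i| < 1) → ‖W x‖ = 1) →
          IntegrableOn (fun x => ∑ i : Fin 3, ‖GW x (EuclideanSpace.single i (1:ℝ))‖ ^ 2) {x : EuclideanSpace ℝ (Fin 3) | ∀ i : Fin 3, |x i| < 1} →
          (∃ ρ' : ℝ, ρ' < ρ ∧ ∀ x : EuclideanSpace ℝ (Fin 3), x ∉ ball y ρ' → W x = U x) →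
          ∫ x in ball y ρ, ∑ i : Fin 3, ‖G x (EuclideanSpace.single i (1:ℝ))‖ ^ 2 ≤ ∫ x in ball y ρ, ∑ i : Fin 3, ‖GW x (EuclideanSpace.single i (1:ℝ))‖ ^ 2)) →
      ∀ Θ : ℝ, (∀ r : ℝ, 0 < r → r ≤ 1 / 2 → ∫ x in ball (0 : EuclideanSpace ℝ (Fin 3)) r, ∑ i : Fin 3, ‖G x (EuclideanSpace.single i (1:ℝ))‖ ^ 2 = Θ * r) →
        Θ ≤ 3 * Real.pi → Θ = 0)
    : Summit.QuantumFields.YangMills.Theses.PoincareLipschitz.BlockLipschitzL :=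
  blockLipschitzL_of_hImprove (hImprove_of_core (hImproveCore_of_flat
    (hImproveCoreFlat_of_stubs (uniformSmallScaleEnergy_band_of_gap hGap) stub_latticeToContinuumLimit)))

/-- ★★★ **K2-LANE FACE v11 (registry-rows variant): THE CRUX BY NAME FROM K1-exp, THE 8π GAP AND THE QUANTILE ROW (Q).** [cite: Balaban1985UV3, (71) p.273; SchoenUhlenbeck1984, Lemma 1.1] -/
theorem historyTailL_of_gap_quantile
    (hK1 : ∀ (L : ℕ), ∃ (Cc cc : ℝ), 0 ≤ Cc ∧ 0 < cc ∧ ∃ γ₁ : ℝ, 0 < γ₁ ∧ γ₁ ≤ 1 ∧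
      ∀ (F : T3Family) (γ : ℝ), F.L = L → 0 < γ → γ ≤ γ₁ → ∀ (K n : ℕ), 1 ≤ n →
        (n : ℝ) ≤ (F.scheme ℰp γ).β K → 2 * n ≤ (F.P K).sitesPerDir 0 →
        ∀ (x₀ : Site (F.P K) 0) (f : GaugeField (F.P K) 0 (Matrix.specialUnitaryGroup (Fin 2) ℂ) → ℝ) (Λ : ℝ), 0 < Λ →
          Measurable f → GaugeField.GaugeInvariant f →
          (∀ U U' : GaugeField (F.P K) 0 (Matrix.specialUnitaryGroup (Fin 2) ℂ),
            (∀ b : PBond (F.P K) 0, (∀ k, (b.src k - x₀ k).val < n) → (∀ k, (b.tgt k - x₀ k).val < n) → U b = U' b) →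
              f U = f U') →
          (∀ U U' : GaugeField (F.P K) 0 (Matrix.specialUnitaryGroup (Fin 2) ℂ),
            |f U - f U'| ≤ Λ * Real.sqrt (∑ b : PBond (F.P K) 0, GaugeGroup.dist1 (U b * (U' b)⁻¹) ^ 2)) →
          ∀ r : ℝ, 0 ≤ r →
            (gibbsK F ℰp γ K).real {U | r ≤ f U - ∫ V, f V ∂(gibbsK F ℰp γ K)} ≤
              Cc * Real.exp (-(cc * Real.sqrt ((F.scheme ℰp γ).β K) * r / ((n : ℝ) * Λ))))
    (hGap : ∀ (hQ : IsOpen {x : EuclideanSpace ℝ (Fin 3) | ∀ i : Fin 3, |x i| < 1}) (U : EuclideanSpace ℝ (Fin 3) → EuclideanSpace ℝ (Fin 4)) (G : EuclideanSpace ℝ (Fin 3) → (EuclideanSpace ℝ (Fin 3) →L[ℝ] EuclideanSpace ℝ (Fin 4))),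
      (HasWeakFDerivOn ⟨{x : EuclideanSpace ℝ (Fin 3) | ∀ i : Fin 3, |x i| < 1}, hQ⟩ volume U G ∧
        (∀ x : EuclideanSpace ℝ (Fin 3), (∀ i : Fin 3, |x i| < 1) → ‖U x‖ = 1) ∧
        IntegrableOn (fun x => ∑ i : Fin 3, ‖G x (EuclideanSpace.single i (1:ℝ))‖ ^ 2) {x : EuclideanSpace ℝ (Fin 3) | ∀ i : Fin 3, |x i| < 1} ∧
        (∀ (y : EuclideanSpace ℝ (Fin 3)) (ρ : ℝ), 0 < ρ → closedBall y ρ ⊆ {x : EuclideanSpace ℝ (Fin 3) | ∀ i : Fin 3, |x i| < 1} →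
          ∀ (W : EuclideanSpace ℝ (Fin 3) → EuclideanSpace ℝ (Fin 4)) (GW : EuclideanSpace ℝ (Fin 3) → (EuclideanSpace ℝ (Fin 3) →L[ℝ] EuclideanSpace ℝ (Fin 4))),
          HasWeakFDerivOn ⟨{x : EuclideanSpace ℝ (Fin 3) | ∀ i : Fin 3, |x i| < 1}, hQ⟩ volume W GW →
          (∀ x : EuclideanSpace ℝ (Fin 3), (∀ i : Fin 3, |x i| < 1) → ‖W x‖ = 1) →
          IntegrableOn (fun x => ∑ i : Fin 3, ‖GW x (EuclideanSpace.single i (1:ℝ))‖ ^ 2) {x : EuclideanSpace ℝ (Fin 3) | ∀ i : Fin 3, |x i| < 1} →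
          (∃ ρ' : ℝ, ρ' < ρ ∧ ∀ x : EuclideanSpace ℝ (Fin 3), x ∉ ball y ρ' → W x = U x) →
          ∫ x in ball y ρ, ∑ i : Fin 3, ‖G x (EuclideanSpace.single i (1:ℝ))‖ ^ 2 ≤ ∫ x in ball y ρ, ∑ i : Fin 3, ‖GW x (EuclideanSpace.single i (1:ℝ))‖ ^ 2)) →
      ∀ Θ : ℝ, (∀ r : ℝ, 0 < r → r ≤ 1 / 2 → ∫ x in ball (0 : EuclideanSpace ℝ (Fin 3)) r, ∑ i : Fin 3, ‖G x (EuclideanSpace.single i (1:ℝ))‖ ^ 2 = Θ * r) →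
        Θ ≤ 3 * Real.pi → Θ = 0)
    (hQ : ∀ (L : ℕ) (b₀ p₀ : ℝ), 0 < b₀ → 2 < p₀ → ∃ γ₁ : ℝ, 0 < γ₁ ∧ γ₁ ≤ 1 ∧ ∀ (F : T3Family) (γ : ℝ), F.L = L → 0 < γ → γ ≤ γ₁ →
            ∀ (K j : ℕ), 1 ≤ j → j + 2 ≤ K → ∀ a : Plaq (F.P K) j,
              3 / 4 ≤ (gibbsK F ℰp γ K).real {U : GaugeField (F.P K) 0 (Matrix.specialUnitaryGroup (Fin 2) ℂ) | GaugeGroup.dist1 (GaugeField.plaqHol (Averaging.iter (fun i' => BlockAveraging.blockAvg (P := F.P K) (j := i') ℰp) j U) a) ≤ θBal F.L γ b₀ p₀ (K - j) / 8})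
    : Summit.QuantumFields.YangMills.Theses.UnitScaleTilt.HistoryTailL :=
  historyTailL_of_expConcentration_quantile hK1 (blockLipschitzL_of_gap hGap) hQ

/-- ★★★ **K2-LANE FACE v11: THE CRUX BY NAME FROM K1-exp, THE 8π GAP AND ONE VARIANCE STATEMENT.** [cite: Balaban1985UV3, (71) p.273; SchoenUhlenbeck1984, Lemma 1.1] -/
theorem historyTailL_of_gap_secondMoment
    (hK1 : ∀ (L : ℕ), ∃ (Cc cc : ℝ), 0 ≤ Cc ∧ 0 < cc ∧ ∃ γ₁ : ℝ, 0 < γ₁ ∧ γ₁ ≤ 1 ∧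
      ∀ (F : T3Family) (γ : ℝ), F.L = L → 0 < γ → γ ≤ γ₁ → ∀ (K n : ℕ), 1 ≤ n →
        (n : ℝ) ≤ (F.scheme ℰp γ).β K → 2 * n ≤ (F.P K).sitesPerDir 0 →
        ∀ (x₀ : Site (F.P K) 0) (f : GaugeField (F.P K) 0 (Matrix.specialUnitaryGroup (Fin 2) ℂ) → ℝ) (Λ : ℝ), 0 < Λ →
          Measurable f → GaugeField.GaugeInvariant f →
          (∀ U U' : GaugeField (F.P K) 0 (Matrix.specialUnitaryGroup (Fin 2) ℂ),
            (∀ b : PBond (F.P K) 0, (∀ k, (b.src k - x₀ k).val < n) → (∀ k, (b.tgt k - x₀ k).val < n) → U b = U' b) →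
              f U = f U') →
          (∀ U U' : GaugeField (F.P K) 0 (Matrix.specialUnitaryGroup (Fin 2) ℂ),
            |f U - f U'| ≤ Λ * Real.sqrt (∑ b : PBond (F.P K) 0, GaugeGroup.dist1 (U b * (U' b)⁻¹) ^ 2)) →
          ∀ r : ℝ, 0 ≤ r →
            (gibbsK F ℰp γ K).real {U | r ≤ f U - ∫ V, f V ∂(gibbsK F ℰp γ K)} ≤
              Cc * Real.exp (-(cc * Real.sqrt ((F.scheme ℰp γ).β K) * r / ((n : ℝ) * Λ))))
    (hGap : ∀ (hQ : IsOpen {x : EuclideanSpace ℝ (Fin 3) | ∀ i : Fin 3, |x i| < 1}) (U : EuclideanSpace ℝ (Fin 3) → EuclideanSpace ℝ (Fin 4)) (G : EuclideanSpace ℝ (Fin 3) → (EuclideanSpace ℝ (Fin 3) →L[ℝ] EuclideanSpace ℝ (Fin 4))),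
      (HasWeakFDerivOn ⟨{x : EuclideanSpace ℝ (Fin 3) | ∀ i : Fin 3, |x i| < 1}, hQ⟩ volume U G ∧
        (∀ x : EuclideanSpace ℝ (Fin 3), (∀ i : Fin 3, |x i| < 1) → ‖U x‖ = 1) ∧
        IntegrableOn (fun x => ∑ i : Fin 3, ‖G x (EuclideanSpace.single i (1:ℝ))‖ ^ 2) {x : EuclideanSpace ℝ (Fin 3) | ∀ i : Fin 3, |x i| < 1} ∧
        (∀ (y : EuclideanSpace ℝ (Fin 3)) (ρ : ℝ), 0 < ρ → closedBall y ρ ⊆ {x : EuclideanSpace ℝ (Fin 3) | ∀ i : Fin 3, |x i| < 1} →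
          ∀ (W : EuclideanSpace ℝ (Fin 3) → EuclideanSpace ℝ (Fin 4)) (GW : EuclideanSpace ℝ (Fin 3) → (EuclideanSpace ℝ (Fin 3) →L[ℝ] EuclideanSpace ℝ (Fin 4))),
          HasWeakFDerivOn ⟨{x : EuclideanSpace ℝ (Fin 3) | ∀ i : Fin 3, |x i| < 1}, hQ⟩ volume W GW →
          (∀ x : EuclideanSpace ℝ (Fin 3), (∀ i : Fin 3, |x i| < 1) → ‖W x‖ = 1) →
          IntegrableOn (fun x => ∑ i : Fin 3, ‖GW x (EuclideanSpace.single i (1:ℝ))‖ ^ 2) {x : EuclideanSpace ℝ (Fin 3) | ∀ i : Fin 3, |x i| < 1} →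
          (∃ ρ' : ℝ, ρ' < ρ ∧ ∀ x : EuclideanSpace ℝ (Fin 3), x ∉ ball y ρ' → W x = U x) →
          ∫ x in ball y ρ, ∑ i : Fin 3, ‖G x (EuclideanSpace.single i (1:ℝ))‖ ^ 2 ≤ ∫ x in ball y ρ, ∑ i : Fin 3, ‖GW x (EuclideanSpace.single i (1:ℝ))‖ ^ 2)) →
      ∀ Θ : ℝ, (∀ r : ℝ, 0 < r → r ≤ 1 / 2 → ∫ x in ball (0 : EuclideanSpace ℝ (Fin 3)) r, ∑ i : Fin 3, ‖G x (EuclideanSpace.single i (1:ℝ))‖ ^ 2 = Θ * r) →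
        Θ ≤ 3 * Real.pi → Θ = 0)
    (hSM : ∀ (L : ℕ), ∃ C : ℝ, 0 ≤ C ∧ ∃ γ₁ : ℝ, 0 < γ₁ ∧ γ₁ ≤ 1 ∧ ∀ (F : T3Family) (γ : ℝ), F.L = L → 0 < γ → γ ≤ γ₁ →
          ∀ (K j : ℕ), 1 ≤ j → j ≤ K → ∀ a : Plaq (F.P K) j,
            ∫ U, (GaugeGroup.dist1 (GaugeField.plaqHol (Averaging.iter (fun i' => BlockAveraging.blockAvg (P := F.P K) (j := i') ℰp) j U) a)) ^ 2 ∂(gibbsK F ℰp γ K)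
              ≤ C * (γ * ((F.L : ℝ)⁻¹) ^ (K - j)))
    : Summit.QuantumFields.YangMills.Theses.UnitScaleTilt.HistoryTailL :=
  historyTailL_of_expConcentration_quantile hK1 (blockLipschitzL_of_gap hGap) (quantileDeviation_of_secondMoment hSM)

end Summit.QuantumFields.YangMills.Theorems.PoincareLipschitzHistoryTailOfGap

end
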